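import Summits.HodgeConjecture.HodgeConjecture.Theorems.K2E1bArchPacketSignsDefs
import HarnessLib

/-!
# K2 ∕ E1b unit U8 — GLUE ★ «the letter from its parts» (LEVEL-B′ assembly, kernel-checked composition)

Cell hodgecm-mathlib, Track B «K2-LIT», engine E1b, unit U8 «archimedean packet signs»; crux item h413 = stmt-HodgeConjecture-24833;
author K2E1b-plan (g3).  TABLE `Cruxes/H413/Lines/K2_E1b_GKCohomologyU21_U8_ArchPacketSigns.md` ED. 7 §2c (LEVEL B′) cuts the open XL socket
U8-1 `sig_K2E1bArchPacketSigns : ArchPacketSignsLetter` (★ `Theorems/K2E1bArchPacketSignsDefs.lean`) along the INFINITESIMAL CHARACTER — the cut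
of the print ([ClozelDelorme1990] Prop. 4 + Corollaire; Wallach, arXiv:1106.1127, Lemma 5.23: a pseudo-coefficient is `K`-finite, its trace is `1`
on its discrete-series class, `0` on every other basic class, and NON-ZERO ONLY ON ITS OWN INFINITESIMAL CHARACTER) — instead of along
tempered ∕ non-tempered (the retired U8-7 ∕ U8-8 cut).  THIS FILE is the composition, PROVED, with the parts as hypotheses and NOTHING ELSE:

* a carrier table `T : DSPacketCarriers` with its three Level-A laws `LawDistinct`, `LawChi`, `LawGlob` (rows U8-4: the record table over ★
  `K2E1bDSCellData.dsCellDatum`);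
* (8a) «CLOZEL–DELORME PSEUDO-COEFFICIENT WITH χ-SUPPORT» for the members of `T`: for regular `(a,b,c)` and `j : Fin 3` an archimedean test function
  `f` with `Θ_ϖ(f) = δ_{ij}` on every unitary globalization `ϖ` of `T.cls a b c i`, and `Θ_ϖ(f) = c ≠ 0` on a unitary globalization of a class `x`
  ONLY IF `P a b c j x` — the SUPPORT PREDICATE `P` is a parameter here (the socket instantiates it with «`x` is χ-pinned coh-unitary with the
  `(κ, e)` of `φ(a,b,c)` and has the cubic pin of `T.cls a b c j`», i.e. «same infinitesimal character», ★ `IsChiPinnedCohUnitary` + the cubic leaf);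
* (8b) «UNITARY DUAL AT A REGULAR INTEGRAL INFINITESIMAL CHARACTER»: `P a b c j x → ∃ i, x = T.cls a b c i` (Rogawski1990 §12.3: `Π(φ) = {F_φ, J_φ^±,
  D_φ, D_φ^±}` and at regular `φ` only the three `D`'s are unitary [Wallach]; Kovačević's classification in E1b currency);
* (U8-11, ★ `K2E1bIrredUnitaryHasGKClass`) an irreducible unitary `ϖ` globalizes SOME class; (U8-10a, ★ `K2E1bArchOpTraceExists`) `ϖ(f)` has a trace.

THE PROOF (clause 3 of `LawPseudoCoeff` by contradiction): let `ϖ` be irreducible unitary globalizing no member; by U8-11 it globalizes some `x`;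
by U8-10a `Θ_ϖ(f_j) = c` for some `c`; if `c = 0` we are done; else (8a) gives `P a b c j x`, (8b) gives `x = T.cls a b c i`, contradicting the
hypothesis.  Clauses 1–2 are (8a)'s first two conjuncts (one `f_j` per `j`, assembled by choice over `Fin 3`).  Pure logic over ★ notions:
no measure theory, no representation theory is done here; `T`, `P` and the five parts are binders, so the theorem lands before the LEVEL-B′ sockets
are typed and is what their edition composes BY NAME.

Sources: [ClozelDelorme1990] L. Clozel, P. Delorme, Ann. sci. ÉNS 23 (1990) 193–228, Prop. 4 + Corollaire pp. 213–214 (AUDIT: corpus key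
`paper:doi-10-24033-asens-1602` p0021.txt L18–46, p0022.txt L3–12); Wallach, arXiv:1106.1127 Lemma 5.23–5.24 (p0016.txt L23–37);
[Rogawski1990] §12.3 pp. 176–178, §13.8 p. 218; [Knapp1986] Thm. 10.2.

HONEST LABEL: HC_CM is proved only modulo the 7 printed citations (2 remaining named inputs: hLiu418 = stmt-HodgeConjecture-24832,
h413 = stmt-HodgeConjecture-24833) until rung 0 closes; this file is glue — it closes nothing until (8a), (8b) and the U8-4 laws are paid.
-/

set_option autoImplicit false
set_option linter.dupNamespace false

noncomputable section

open NumberField MeasureTheory CompactlySupported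
open scoped Matrix MatrixGroups InnerProductSpace ENNReal

namespace Summit.HodgeConjecture.HodgeConjecture.Cruxes.H413.K2E1bGKCohomologyU21.U8

open Literature.NumberTheory.Automorphic
open Literature.RepresentationTheory.KonnoKonno2007 Literature.RepresentationTheory.KonnoKonno2007.RealDualPair

/-! ## §1 The five parts as named statements (parametric in the table `T` and the support predicate `P`) -/

/-- **(8a) Clozel–Delorme pseudo-coefficient with support predicate `P`** for the members of the table `T`: per regular parameter and member `j`,
an archimedean test function with trace `δ_{ij}` on the unitary globalizations of the members and non-zero trace on a unitary globalization of a
class `x` (trace value `t ≠ 0`) only if `P a b c j x`. [cite: ClozelDelorme1990, Prop. 4, Corollaire] [cite: Rogawski1990, §13.8 p. 218] -/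
def CDPseudoCoeffWith (T : DSPacketCarriers) (P : ℤ → ℤ → ℤ → Fin 3 → GKIrrClass (uFormGroup (Fin 2) (Fin 1)) → Prop) : Prop :=
  ∀ [MeasurableSpace ↥(uFormGroup (Fin 2) (Fin 1)).carrier] [BorelSpace ↥(uFormGroup (Fin 2) (Fin 1)).carrier]
    (ν : Measure ↥(uFormGroup (Fin 2) (Fin 1)).carrier) [ν.IsHaarMeasure] (a b c : ℤ), IsRegularParam a b c → ∀ j : Fin 3,
    ∃ f : C_c(↥(uFormGroup (Fin 2) (Fin 1)).carrier, ℂ), IsArchTestU21 f ∧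
      (∀ (i : Fin 3) (E : Type) [NormedAddCommGroup E] [InnerProductSpace ℂ E] [CompleteSpace E]
          (ϖ : ContRepresentation ℂ ↥(uFormGroup (Fin 2) (Fin 1)).carrier E)
          (hϖ : IsUnitaryGlobalization (uFormGroup (Fin 2) (Fin 1)) (T.cls a b c i) ϖ),
          HasArchOpTrace ν ϖ hϖ.isUnitary hϖ.isStronglyContinuous f (if i = j then 1 else 0)) ∧
      (∀ (x : GKIrrClass (uFormGroup (Fin 2) (Fin 1))) (E : Type) [NormedAddCommGroup E] [InnerProductSpace ℂ E] [CompleteSpace E]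
          (ϖ : ContRepresentation ℂ ↥(uFormGroup (Fin 2) (Fin 1)).carrier E)
          (hϖ : IsUnitaryGlobalization (uFormGroup (Fin 2) (Fin 1)) x ϖ) (t : ℂ),
          HasArchOpTrace ν ϖ hϖ.isUnitary hϖ.isStronglyContinuous f t → t ≠ 0 → P a b c j x)

/-- **(8b) Unitary dual at a regular integral infinitesimal character, relative to `T` and `P`**: a class satisfying the support predicate of member
`j` IS a member. [cite: Rogawski1990, §12.3 pp. 176–178] [cite: Kovacevic2021, Thm. 4] -/
def UnitaryDualWith (T : DSPacketCarriers) (P : ℤ → ℤ → ℤ → Fin 3 → GKIrrClass (uFormGroup (Fin 2) (Fin 1)) → Prop) : Prop :=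
  ∀ a b c : ℤ, IsRegularParam a b c → ∀ (j : Fin 3) (x : GKIrrClass (uFormGroup (Fin 2) (Fin 1))), P a b c j x → ∃ i : Fin 3, x = T.cls a b c i

/-- **(U8-11) every irreducible unitary `ϖ` globalizes some class** — the statement of ★ `sig_K2E1bIrredUnitaryHasGKClass`, as a `Prop`
(print: KnappVogan1995, Introduction Thms. 0.2–0.4) — a binder-less statement-name over Summits notions, PROVED in the tree
(★ `exists_isUnitaryGlobalization_of_isTopIrreducible`), hence untagged (gate note: not a Literature fact, no relocation). -/
def IrredUnitaryHasGKClassStmt : Prop :=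
  ∀ (E : Type) [NormedAddCommGroup E] [InnerProductSpace ℂ E] [CompleteSpace E]
    (ϖ : ContRepresentation ℂ ↥(uFormGroup (Fin 2) (Fin 1)).carrier E),
    ϖ.IsUnitary → ϖ.IsStronglyContinuous → ϖ.IsTopIrreducible →
    ∃ x : GKIrrClass (uFormGroup (Fin 2) (Fin 1)), IsUnitaryGlobalization (uFormGroup (Fin 2) (Fin 1)) x ϖ

/-- **(U8-10a) `ϖ(f)` has a trace** — the statement of ★ `sig_K2E1bArchOpTraceExists`, as a `Prop` (print: Knapp1986, Thm. 10.2) — a binder-less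
statement-name over Summits notions, PROVED in the tree (★ `archOpTraceExists`), hence untagged (gate note: not a Literature fact, no relocation). -/
def ArchOpTraceExistsStmt : Prop :=
  ∀ [MeasurableSpace ↥(uFormGroup (Fin 2) (Fin 1)).carrier] [BorelSpace ↥(uFormGroup (Fin 2) (Fin 1)).carrier]
    (ν : Measure ↥(uFormGroup (Fin 2) (Fin 1)).carrier) [ν.IsHaarMeasure]
    (E : Type) [NormedAddCommGroup E] [InnerProductSpace ℂ E] [CompleteSpace E]
    (ϖ : ContRepresentation ℂ ↥(uFormGroup (Fin 2) (Fin 1)).carrier E) (hu : ϖ.IsUnitary) (hsc : ϖ.IsStronglyContinuous),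
    ϖ.IsTopIrreducible → ∀ f : C_c(↥(uFormGroup (Fin 2) (Fin 1)).carrier, ℂ), IsArchTestU21 f →
    ∃ c : ℂ, HasArchOpTrace ν ϖ hu hsc f c

/-! ## §2 The composition -/

/-- **`LawPseudoCoeff` from the parts** at one real place `ν`. [cite: ClozelDelorme1990, Prop. 4, Corollaire] [cite: Rogawski1990, §13.8 p. 218] -/
theorem lawPseudoCoeff_of_parts (T : DSPacketCarriers) (P : ℤ → ℤ → ℤ → Fin 3 → GKIrrClass (uFormGroup (Fin 2) (Fin 1)) → Prop)
    (h8a : CDPseudoCoeffWith T P) (h8b : UnitaryDualWith T P) (h11 : IrredUnitaryHasGKClassStmt) (h10a : ArchOpTraceExistsStmt)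
    [MeasurableSpace ↥(uFormGroup (Fin 2) (Fin 1)).carrier] [BorelSpace ↥(uFormGroup (Fin 2) (Fin 1)).carrier]
    (ν : Measure ↥(uFormGroup (Fin 2) (Fin 1)).carrier) [ν.IsHaarMeasure] : T.LawPseudoCoeff ν := by
  intro a b c habc
  choose f hf hδ hP using fun j : Fin 3 => h8a ν a b c habc j
  refine ⟨f, hf, fun i j E _ _ _ ϖ hϖ => hδ j i E ϖ hϖ, ?_⟩
  intro E _ _ _ ϖ hu hsc hirr hno j
  obtain ⟨x, hx⟩ := h11 E ϖ hu hsc hirr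
  obtain ⟨c₀, hc₀⟩ := h10a ν E ϖ hu hsc hirr (f j) (hf j)
  by_cases hzero : c₀ = 0
  · exact hzero ▸ hc₀
  · exfalso
    obtain ⟨i, rfl⟩ := h8b a b c habc j x (hP j x E ϖ hx c₀ hc₀ hzero)
    exact hno i hx

/-- **THE LETTER FROM ITS PARTS (LEVEL B′).**  A table with the three Level-A laws, a Clozel–Delorme pseudo-coefficient with support predicate `P`
for its members (8a), the unitary dual at regular χ relative to `P` (8b), and the two ★ analytic facts U8-11, U8-10a give ★ `ArchPacketSignsLetter`.
[cite: ClozelDelorme1990, Prop. 4, Corollaire] [cite: Rogawski1990, §12.3 pp. 176–178] [cite: Rogawski1990, §13.8 p. 218] -/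
theorem archPacketSignsLetter_of_parts (T : DSPacketCarriers) (P : ℤ → ℤ → ℤ → Fin 3 → GKIrrClass (uFormGroup (Fin 2) (Fin 1)) → Prop)
    (hD : T.LawDistinct) (hχ : T.LawChi) (hG : T.LawGlob)
    (h8a : CDPseudoCoeffWith T P) (h8b : UnitaryDualWith T P) (h11 : IrredUnitaryHasGKClassStmt) (h10a : ArchOpTraceExistsStmt) :
    ArchPacketSignsLetter :=
  ⟨T, hD, hχ, hG, fun ν _ => lawPseudoCoeff_of_parts T P h8a h8b h11 h10a ν⟩

/-- **Monotonicity in the support predicate**: (8a) with a SHARPER support predicate implies (8a) with a weaker one — so the socket may pin MORE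
than (8b) consumes. [folklore] -/
theorem CDPseudoCoeffWith.mono {T : DSPacketCarriers} {P Q : ℤ → ℤ → ℤ → Fin 3 → GKIrrClass (uFormGroup (Fin 2) (Fin 1)) → Prop}
    (hPQ : ∀ a b c j x, P a b c j x → Q a b c j x) (h : CDPseudoCoeffWith T P) : CDPseudoCoeffWith T Q := by
  intro _ _ ν _ a b c habc j
  obtain ⟨f, hf, hδ, hP⟩ := h ν a b c habc j
  exact ⟨f, hf, hδ, fun x E _ _ _ ϖ hϖ c₀ hc hne => hPQ a b c j x (hP x E ϖ hϖ c₀ hc hne)⟩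

/-- **Antitonicity of (8b)**: the unitary dual relative to a WEAKER predicate implies it relative to a sharper one. [folklore] -/
theorem UnitaryDualWith.anti {T : DSPacketCarriers} {P Q : ℤ → ℤ → ℤ → Fin 3 → GKIrrClass (uFormGroup (Fin 2) (Fin 1)) → Prop}
    (hPQ : ∀ a b c j x, P a b c j x → Q a b c j x) (h : UnitaryDualWith T Q) : UnitaryDualWith T P :=
  fun a b c habc j x hx => h a b c habc j x (hPQ a b c j x hx)

end Summit.HodgeConjecture.HodgeConjecture.Cruxes.H413.K2E1bGKCohomologyU21.U8

end
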